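import Literature.Computability.AlgebraicComplexity.VNPClosedUnderDifferentiation
import Literature.Computability.AlgebraicComplexity.VNPClosedUnderCoefficientsInfinite
import Mathlib.Algebra.CharZero.Infinite
import Literature.Computability.AlgebraicComplexity.VNPClosedUnderSum
import Literature.Computability.AlgebraicComplexity.PermanentAsCoefficient
import Literature.Computability.AlgebraicComplexity.ValiantConjectureEquivProofs
import Literature.RingTheory.MvPolynomial.IteratedDerivations
import Mathlib.Algebra.MvPolynomial.PDeriv
import HarnessLib

/-!
# `VNP` is closed under iterated partial derivatives of `n`-dependent order (Valiant 1982;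
# Bürgisser 2024 survey, §3.1) — PROVED (v1 in characteristic zero; v3 over every field), via the multivariate Taylor formula

Topic `Computability/AlgebraicComplexity`. Cell `val-lit`, row Bur2024-A (Bürgisser 2024 survey,
arXiv:2406.06217), §3.1 "Robustness" (held text `paper:arxiv-2406.06217`, p0013 L39–L40):

> Valiant also proved in [vali:82] that `VNP` is closed under `p`-bounded applications of
> differentiation and integration.

`VNPClosedUnderDifferentiation.lean` proves the case of ONE partial derivative
(`isVNPFamily_pderiv`) and hence of any FIXED number of them (`isVNPFamily_pderiv_iterate`); its
module docstring leaves the printed statement — `p(n)`-fold derivatives along `n`-dependent words of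
variables — as `TODO(general form)`, because iterating a closure property `p(n)` times compounds
the polynomial blow-up `p(n)` times. This file closes that gap: **for every `p`-definable family
`(f_k)` and EVERY sequence of words `l_k = [v₁, …, v_r]` of variables (no bound on the length
`r = r(k)` is needed), the family of iterated partial derivatives `∂_{v₁} ⋯ ∂_{v_r} f_k` is
`p`-definable** (`IsVNPFamily.foldr_pderiv`; v1: characteristic zero, inherited from the tree's
Prop. 3.1 `IsVNPFamily.coeff`; v2 (val-lit-t09 g10): over every infinite field; **v3: over EVERY
field**, via `IsVNPFamily.coeff_sumAlgEquiv_of_infinite` of `VNPClosedUnderCoefficientsInfinite.lean`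
(which since its v2 has no hypothesis on the field) — every earlier use still applies).

Route (the standard one-step reduction to Prop. 3.1 — the survey prints no proof): the full
Taylor shift `p(X + T)` in a fresh copy `T` of the variables satisfies the multivariate Taylor
formula
`∂_l p = (∏_w m_w!) · [T^m] p(X + T)`, `m = counts l` the exponent vector of the word `l`
(`foldr_pderiv_eq_C_mul_coeff_taylor`; any commutative semiring), proved by induction on the word
from the exchange identity `∂/∂X_c [T^m] p(X+T) = (m_c + 1) · [T^{m + e_c}] p(X+T)`
(`pderiv_coeff_taylor`, i.e. `∂/∂X_c` and `∂/∂T_c` agree on `p(X + T)`, by induction on `p`);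
the shifted family is in `VNP` (`isVNPFamily_taylorShiftAll`: substitute `X_w + T_w` into the `VP`
witnesses, `#vars` extra gates; Boolean summation commutes with the substitution,
`boolSum_aeval_extend`); `VNP` is closed under taking coefficients (Prop. 3.1, here in the form
`IsVNPFamily.coeff_sumAlgEquiv` for an arbitrary finite block of distinguished variables, by
renaming the block to `Fin a`) and under scalar multiples (`IsVNPFamily.C_mul`).

* `sumAlgEquiv_taylorShiftAll` — `p(X + T)` read in `R[X][T]`;
* `coeff_zero_taylor`, **`pderiv_coeff_taylor`**, `prod_factorial_add_single`,
  **`foldr_pderiv_eq_C_mul_coeff_taylor`** (multivariate Taylor formula along a word),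
  `foldr_pderiv_eq_C_mul_coeff_sumAlgEquiv_taylorShiftAll` (two-block form),
  `foldr_pderiv_eq_iterD` (bridge to the tree's `iterD (dmap pderiv)` of
  `Literature/RingTheory/MvPolynomial/IteratedDerivations.lean`);
* **`IsVNPFamily.coeff_sumAlgEquiv`** (Prop. 3.1 for any finite
  block of monomial variables), `isVNPFamily_taylorShiftAll`;
* **`IsVNPFamily.foldr_pderiv`** (the closure property as printed, no length bound),
  `IsVNPFamily.iterD_pderiv`, `IsVNPFamily.pderiv_iterate'` (`k`-dependent iteration counts),
  `isVNPFamily_foldr_pderiv_inl` (the closure property in the exact currency of the hypotheses of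
  `PermanentAsCoefficient.lean`'s `IsVNPFamily.isVPFamily_of_pderiv_closed` & co.: `VNP` HAS the
  closure property whose `VP`/`VBP`/`VF` versions would put `PER` in `VP`/`VBP`/`VF`);
* **the survey's two dichotomies for `VP` as EQUIVALENCES** (v4: over every field of
  characteristic `≠ 2`, `…_of_ringChar_ne_two`, the survey's own generality; and characteristic zero):
  `vp_closed_under_coeff_iff_vnp_subset_vp` — "`VP` is closed under taking coefficients
  ⟺ `VNP ⊆ VP`" (→ `PermanentAsCoefficient.lean`; ← Prop. 3.1 `IsVNPFamily.coeff` + `VP ⊆ VNP`),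
  and `vp_closed_under_pderiv_iff_vnp_subset_vp` — "`VP` is closed under `p`-bounded
  differentiation ⟺ `VNP ⊆ VP`" (← this file's `isVNPFamily_foldr_pderiv_inl`); transfer lemma
  `IsVNPFamily.isVPFamily_of_forall_fin` (a `VNP ⊆ VP` hypothesis stated for `Fin`-indexed
  families applies to every finitely indexed family, by renaming).

Scope: the derivative closures `foldr_pderiv` / `iterD_pderiv` / `pderiv_iterate'` /
`isVNPFamily_foldr_pderiv_inl` over every field (v3); `IsVNPFamily.coeff_sumAlgEquiv` and
the `VP` equivalences below remain characteristic zero; the Taylor identities hold over any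
commutative semiring. Integration (the survey's "and integration") is not treated here: the
survey only displays `∂_{y₁}⋯∂_{yₙ} f_n = (3/2)^n ∫_{[-1,1]^n} y₁⋯yₙ f_n dy = PER_n` and Valiant's
1982 definition of the integration operator is not held — v2 note: the formal definite integral
and the closure of `VNP` under iterated integration are now `VNPClosedUnderIntegration.lean`.
Theorems only (no definitions: the shift is spelled out as
`aeval (fun w => X (Sum.inl w) + X (Sum.inr w))`); 0 named facts. Honest framing: closure
bookkeeping of Valiant's class; nothing here bears on `VP` versus `VNP`; `VP ≠ VNP` is NOT proved.

## References

* [Burgisser2024Completeness] P. Bürgisser, *Completeness classes in algebraic complexity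
  theory*, arXiv:2406.06217 (2024), §3.1 (p0013 L39–L47).
* [Valiant1982] L. G. Valiant, *Reducibility by algebraic projections*, L'Enseignement Math. 28
  (1982), 253–268 (the source cited by the survey for this closure property).
* [Burgisser2000] P. Bürgisser, *Completeness and Reduction in Algebraic Complexity Theory*,
  Springer 2000, Def. 2.5 (`VNP`).
-/

noncomputable section

open MvPolynomial
open Literature.RingTheory.MvPolynomial (counts counts_nil counts_cons iterD dmap iterD_nil iterD_cons)

namespace Literature.Computability.AlgebraicComplexity

universe u v w

/-! ## The multivariate Taylor formula along a word of variables -/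

section Taylor

variable {R : Type u} [CommSemiring R] {σ : Type v}

/-- **`p(X + T)` read in `R[X][T]`**: under `sumAlgEquiv` (outer variables = the first block `T`,
coefficients in the second block `X`) the two-block shift `X_w ↦ T_w + X_w` of `p ∈ R[σ]` is the
substitution `X_w ↦ T_w + C(X_w)` with the old variables as constants.
[cite: Burgisser2024Completeness, §3.1 (p0013 L39–L40)] -/
theorem sumAlgEquiv_taylorShiftAll (p : MvPolynomial σ R) :
    sumAlgEquiv R σ σ (aeval (fun w => X (Sum.inl w) + X (Sum.inr w) :
        σ → MvPolynomial (σ ⊕ σ) R) p) =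
      aeval (fun w => X w + C (X w) : σ → MvPolynomial σ (MvPolynomial σ R)) p := by
  have key : (sumAlgEquiv R σ σ).toAlgHom.comp
      (aeval (fun w => X (Sum.inl w) + X (Sum.inr w) : σ → MvPolynomial (σ ⊕ σ) R)) =
      aeval (fun w => X w + C (X w) : σ → MvPolynomial σ (MvPolynomial σ R)) := by
    refine algHom_ext fun w => ?_
    change sumAlgEquiv R σ σ (aeval _ (X w)) = aeval _ (X w)
    rw [aeval_X, aeval_X, map_add, sumAlgEquiv_X_inl, sumAlgEquiv_X_inr]
  exact AlgHom.congr_fun key p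

/-- **`[T⁰] p(X + T) = p`.** [cite: Burgisser2024Completeness, §3.1 (p0013 L39–L40)] -/
theorem coeff_zero_taylor (p : MvPolynomial σ R) :
    coeff 0 (aeval (fun w => X w + C (X w) : σ → MvPolynomial σ (MvPolynomial σ R)) p) = p := by
  rw [← constantCoeff_eq]
  have key : constantCoeff.comp (aeval (fun w => X w + C (X w) :
      σ → MvPolynomial σ (MvPolynomial σ R))).toRingHom = RingHom.id _ := by
    refine ringHom_ext (fun c => ?_) (fun w => ?_)
    · rw [RingHom.comp_apply, AlgHom.toRingHom_eq_coe, AlgHom.coe_toRingHom, algHom_C,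
        MvPolynomial.algebraMap_apply, algebraMap_eq, constantCoeff_C, RingHom.id_apply]
    · rw [RingHom.comp_apply, AlgHom.toRingHom_eq_coe, AlgHom.coe_toRingHom, aeval_X,
        RingHom.id_apply, map_add, constantCoeff_X, constantCoeff_C, zero_add]
  exact RingHom.congr_fun key p

/-- **The exchange identity `∂/∂X_c = ∂/∂T_c` on `p(X + T)`, coefficientwise**: for every
exponent vector `m`, `∂/∂X_c ([T^m] p(X + T)) = (m_c + 1) · [T^{m + e_c}] p(X + T)` (induction on
`p`; for `p · X_w` use `[T^m](q (T_w + X_w)) = [T^{m - e_w}] q + X_w [T^m] q`).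
[cite: Burgisser2024Completeness, §3.1 (p0013 L39–L40)] -/
theorem pderiv_coeff_taylor [DecidableEq σ] (c : σ) (p : MvPolynomial σ R) (m : σ →₀ ℕ) :
    pderiv c (coeff m (aeval (fun w => X w + C (X w) : σ → MvPolynomial σ (MvPolynomial σ R)) p)) =
      (m c + 1) • coeff (m + Finsupp.single c 1)
        (aeval (fun w => X w + C (X w) : σ → MvPolynomial σ (MvPolynomial σ R)) p) := by
  induction p using MvPolynomial.induction_on generalizing m with
  | C a =>
    have hne : m + Finsupp.single c 1 ≠ 0 := fun h => by
      have := DFunLike.congr_fun h c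
      simp at this
    rw [algHom_C, MvPolynomial.algebraMap_apply, algebraMap_eq, coeff_C, coeff_C,
      if_neg (Ne.symm hne), smul_zero]
    split_ifs
    · exact pderiv_C
    · exact map_zero _
  | add p q hp hq =>
    rw [map_add, coeff_add, coeff_add, map_add, hp, hq, smul_add]
  | mul_X p w ih =>
    set q := aeval (fun w => X w + C (X w) : σ → MvPolynomial σ (MvPolynomial σ R)) p with hq
    have hcoeff : ∀ m' : σ →₀ ℕ, coeff m' (q * (X w + C (X w))) =
        (if w ∈ m'.support then coeff (m' - Finsupp.single w 1) q else 0) + X w * coeff m' q :=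
      fun m' => by rw [mul_add, coeff_add, coeff_mul_X', mul_comm q (C _), coeff_C_mul]
    rw [map_mul, aeval_X, hcoeff, hcoeff, map_add, pderiv_mul, ih m, smul_add, nsmul_eq_mul,
      nsmul_eq_mul, nsmul_eq_mul]
    by_cases hwc : w = c
    · subst hwc
      have hmem : w ∈ (m + Finsupp.single w 1).support := by
        rw [Finsupp.mem_support_iff, Finsupp.add_apply, Finsupp.single_eq_same]; omega
      rw [if_pos hmem, add_tsub_cancel_right, pderiv_X_self, one_mul]
      by_cases hm : m w = 0
      · have hnot : w ∉ m.support := by rw [Finsupp.mem_support_iff]; exact fun h => h hm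
        rw [if_neg hnot, map_zero, hm]
        push_cast
        ring
      · have hmem' : w ∈ m.support := by rw [Finsupp.mem_support_iff]; exact hm
        have hle : Finsupp.single w 1 ≤ m := Finsupp.single_le_iff.2 (Nat.one_le_iff_ne_zero.2 hm)
        have hc1 : (m - Finsupp.single w 1 : σ →₀ ℕ) w + 1 = m w := by
          rw [Finsupp.tsub_apply, Finsupp.single_eq_same]
          exact Nat.sub_add_cancel (Nat.one_le_iff_ne_zero.2 hm)
        rw [if_pos hmem', ih, nsmul_eq_mul, tsub_add_cancel_of_le hle, hc1]
        push_cast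
        ring
    · rw [pderiv_X_of_ne hwc, zero_mul, zero_add]
      have hiff : w ∈ (m + Finsupp.single c 1).support ↔ w ∈ m.support := by
        rw [Finsupp.mem_support_iff, Finsupp.mem_support_iff, Finsupp.add_apply,
          Finsupp.single_eq_of_ne hwc, add_zero]
      by_cases hw : w ∈ m.support
      · have hle : Finsupp.single w 1 ≤ m :=
          Finsupp.single_le_iff.2 (Nat.one_le_iff_ne_zero.2 (Finsupp.mem_support_iff.1 hw))
        have hc1 : (m - Finsupp.single w 1 : σ →₀ ℕ) c = m c := by
          rw [Finsupp.tsub_apply, Finsupp.single_eq_of_ne (Ne.symm hwc), Nat.sub_zero]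
        rw [if_pos hw, if_pos (hiff.2 hw), ih, nsmul_eq_mul, tsub_add_eq_add_tsub hle, hc1]
        ring
      · rw [if_neg hw, if_neg (fun h => hw (hiff.1 h)), map_zero, mul_zero, zero_add, zero_add]
        ring

/-- Factorials of an exponent vector: `∏_w (m + e_c)_w ! = (m_c + 1) · ∏_w m_w !`. [cite: Burgisser2024Completeness, §3.1 (p0013 L39–L40)] -/
theorem prod_factorial_add_single [DecidableEq σ] (m : σ →₀ ℕ) (c : σ) :
    ((m + Finsupp.single c 1).prod fun _ n => n.factorial) =
      (m c + 1) * m.prod fun _ n => n.factorial := by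
  set s : Finset σ := insert c m.support with hs
  have hsub₁ : (m + Finsupp.single c 1).support ⊆ s := by
    intro w hw
    rw [Finsupp.mem_support_iff, Finsupp.add_apply] at hw
    rw [hs, Finset.mem_insert, Finsupp.mem_support_iff]
    by_cases hwc : w = c
    · exact Or.inl hwc
    · rw [Finsupp.single_eq_of_ne hwc, add_zero] at hw
      exact Or.inr hw
  have hsub₂ : m.support ⊆ s := Finset.subset_insert _ _
  have hc : c ∈ s := Finset.mem_insert_self _ _
  rw [Finsupp.prod_of_support_subset _ hsub₁ _ fun _ _ => Nat.factorial_zero,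
    Finsupp.prod_of_support_subset _ hsub₂ _ fun _ _ => Nat.factorial_zero,
    ← Finset.mul_prod_erase s _ hc, ← Finset.mul_prod_erase s _ hc, Finsupp.add_apply,
    Finsupp.single_eq_same, Nat.factorial_succ, mul_assoc]
  congr 2
  refine Finset.prod_congr rfl fun w hw => ?_
  rw [Finsupp.add_apply, Finsupp.single_eq_of_ne (Finset.ne_of_mem_erase hw), add_zero]

/-- **The multivariate Taylor formula along a word** (any commutative semiring): for a word
`l = [v₁, …, v_r]` of variables with exponent vector `m = counts l` (`m_w` = number of occurrences
of `w` in `l`), the iterated partial derivative is a multiple of a Taylor coefficient,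
`∂_{v₁} ⋯ ∂_{v_r} p = (∏_w m_w!) · [T^m] p(X + T)` in `R[X]` (induction on the word, by
`pderiv_coeff_taylor`). [cite: Burgisser2024Completeness, §3.1 (p0013 L39–L40)] -/
theorem foldr_pderiv_eq_C_mul_coeff_taylor [DecidableEq σ] (l : List σ) (p : MvPolynomial σ R) :
    l.foldr (fun j q => pderiv j q) p =
      C (((counts l).prod fun _ n => n.factorial : ℕ) : R) *
        coeff (counts l) (aeval (fun w => X w + C (X w) : σ → MvPolynomial σ (MvPolynomial σ R)) p) := by
  induction l with
  | nil =>
    rw [List.foldr_nil, counts_nil, Finsupp.prod_zero_index, Nat.cast_one, C_1, one_mul,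
      coeff_zero_taylor]
  | cons c l ih =>
    rw [List.foldr_cons, ih, pderiv_C_mul, pderiv_coeff_taylor, counts_cons,
      add_comm (Finsupp.single c 1) (counts l), prod_factorial_add_single, nsmul_eq_mul,
      ← map_natCast (C : R →+* MvPolynomial σ R), Nat.cast_mul, map_mul]
    ring

/-- Two-block form of the Taylor formula: `∂_l p = (∏_w m_w!) · [T^m] S(p)` with
`S(p) = p(X + T) ∈ R[σ ⊔ σ]` the substitution `X_w ↦ X_{inl w} + X_{inr w}` read through
`sumAlgEquiv`. [cite: Burgisser2024Completeness, §3.1 (p0013 L39–L40)] -/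
theorem foldr_pderiv_eq_C_mul_coeff_sumAlgEquiv_taylorShiftAll [DecidableEq σ] (l : List σ)
    (p : MvPolynomial σ R) :
    l.foldr (fun j q => pderiv j q) p =
      C (((counts l).prod fun _ n => n.factorial : ℕ) : R) *
        coeff (counts l) (sumAlgEquiv R σ σ
          (aeval (fun w => X (Sum.inl w) + X (Sum.inr w) : σ → MvPolynomial (σ ⊕ σ) R) p)) := by
  rw [sumAlgEquiv_taylorShiftAll, foldr_pderiv_eq_C_mul_coeff_taylor]

end Taylor

/-! ## Bridge to the tree's iterated derivations along words -/

section Bridge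

variable {R : Type u} [CommRing R] {σ : Type v}

/-- The right fold of `pderiv` along a word is the tree's iterated derivation
`iterD (dmap pderiv)` of `IteratedDerivations.lean` along that word. [cite: Burgisser2024Completeness, §3.1 (p0013 L39–L40)] -/
theorem foldr_pderiv_eq_iterD (l : List σ) (p : MvPolynomial σ R) :
    l.foldr (fun j q => pderiv j q) p =
      iterD (dmap fun i : σ => (pderiv i : Derivation R (MvPolynomial σ R) (MvPolynomial σ R))) l p := by
  induction l with
  | nil => rfl
  | cons c l ih => rw [List.foldr_cons, iterD_cons, ih]

end Bridge

/-! ## Prop. 3.1 for an arbitrary finite block of monomial variables -/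

section Coeff

variable {R : Type u} [CommSemiring R] {ρ ρ' τ : Type*}

/-- `sumAlgEquiv` commutes with renaming the block of outer variables: reading
`rename (Sum.map e id) p` in `R[τ][ρ']` is `rename e` of `p` read in `R[τ][ρ]` (the case `f = id`
of `ArithCircuitSkeletonRename.lean`'s `sumAlgEquiv_rename_sumMap`, restated to keep the imports
light). [cite: Burgisser2000, Rem. 2.2] -/
private theorem sumAlgEquiv_rename_sumMap_id (e : ρ → ρ') (p : MvPolynomial (ρ ⊕ τ) R) :
    sumAlgEquiv R ρ' τ (rename (Sum.map e id) p) = rename e (sumAlgEquiv R ρ τ p) := by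
  induction p using MvPolynomial.induction_on with
  | C a => rw [rename_C, sumAlgEquiv_C_inl, sumAlgEquiv_C_inl, rename_C]
  | add p q hp hq => rw [map_add, map_add, hp, hq, map_add, map_add]
  | mul_X p x ih =>
    rw [map_mul, map_mul, ih, map_mul, map_mul, rename_X]
    congr 1
    rcases x with r | t
    · rw [Sum.map_inl, sumAlgEquiv_X_inl, sumAlgEquiv_X_inl, rename_X]
    · rw [Sum.map_inr, id, sumAlgEquiv_X_inr, sumAlgEquiv_X_inr, rename_C]

end Coeff

section Family

variable {F : Type u} [Field F]

/-- **Bürgisser 2024, Prop. 3.1 for an arbitrary finite block of distinguished variables**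
(characteristic zero): if `(f_k)` is `p`-definable, `f_k ∈ F[ρ_k ⊔ τ_k]`, and `m_k` is a monomial
in the variables `ρ_k`, then the coefficient sequence `[Y^{m_k}] f_k ∈ F[τ_k]` is `p`-definable —
the tree's `IsVNPFamily.coeff` (block `Fin (a k)`) transported along an enumeration
`ρ_k ≃ Fin #ρ_k` (`IsVNPFamily.renameEquiv`, `sumAlgEquiv_rename_sumMap_id`,
`coeff_rename_mapDomain`). [cite: Burgisser2024Completeness, Prop. 3.1 (§3.1, p0013 L17–L26)] [cite: Valiant1982, §3] -/
theorem IsVNPFamily.coeff_sumAlgEquiv [CharZero F] {ρ τ : ℕ → Type v} [∀ k, Fintype (ρ k)]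
    [∀ k, DecidableEq (ρ k)] [∀ k, Fintype (τ k)] [∀ k, DecidableEq (τ k)]
    {f : ∀ k, MvPolynomial (ρ k ⊕ τ k) F} (hf : IsVNPFamily f) (m : ∀ k, ρ k →₀ ℕ) :
    IsVNPFamily fun k => MvPolynomial.coeff (m k) (sumAlgEquiv F (ρ k) (τ k) (f k)) := by
  let e : ∀ k, ρ k ≃ Fin (Fintype.card (ρ k)) := fun k => Fintype.equivFin (ρ k)
  have hf' : IsVNPFamily fun k => rename (Sum.map (e k) id) (f k) := by
    have h := IsVNPFamily.renameEquiv (fun k => (e k).sumCongr (Equiv.refl (τ k))) hf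
    refine (iff_of_eq (congrArg IsVNPFamily (funext fun k => ?_))).1 h
    rw [renameEquiv_apply]
    rfl
  have h := IsVNPFamily.coeff (a := fun k => Fintype.card (ρ k)) (τ := τ) hf'
    fun k => (m k).mapDomain (e k)
  refine (iff_of_eq (congrArg IsVNPFamily (funext fun k => ?_))).1 h
  rw [sumAlgEquiv_rename_sumMap_id, coeff_rename_mapDomain _ (e k).injective]

variable {σ : ℕ → Type v} [∀ k, Fintype (σ k)]

/-- **The full Taylor shifts `f_k(X + T)` of a `VNP` family form a `VNP` family**: substitute
`X_w + T_w` into the `VP` witnesses (`#σ_k` extra addition gates, twice the variables, degree not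
increased); Boolean summation commutes with the substitution (`boolSum_aeval_extend`).
[cite: Burgisser2024Completeness, §3.1 (p0013 L39–L40)] -/
theorem isVNPFamily_taylorShiftAll {f : ∀ k, MvPolynomial (σ k) F} (hf : IsVNPFamily f) :
    IsVNPFamily fun k => aeval (fun w => X (Sum.inl w) + X (Sum.inr w) :
      σ k → MvPolynomial (σ k ⊕ σ k) F) (f k) := by
  obtain ⟨⟨hvars, hdeg⟩, u, g, ⟨⟨gvars, gdeg⟩, gcx⟩, hfg⟩ := hf
  -- the shifted witnesses
  let θ₀ : ∀ k, σ k → MvPolynomial (σ k ⊕ σ k) F := fun k w => X (Sum.inl w) + X (Sum.inr w)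
  let θ : ∀ k, (σ k ⊕ Fin (u k)) → MvPolynomial ((σ k ⊕ σ k) ⊕ Fin (u k)) F := fun k =>
    Sum.elim (fun w => rename Sum.inl (θ₀ k w)) (fun j => X (Sum.inr j))
  have hθ₀deg : ∀ k w, (θ₀ k w).totalDegree ≤ 1 := fun k w =>
    (totalDegree_add _ _).trans
      (max_le (mvPolynomial_totalDegree_X_le_one _) (mvPolynomial_totalDegree_X_le_one _))
  have hθdeg : ∀ k x, (θ k x).totalDegree ≤ 1 := by
    intro k x
    rcases x with w | j
    · exact (totalDegree_rename_le _ _).trans (hθ₀deg k w)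
    · exact mvPolynomial_totalDegree_X_le_one _
  have hθ₀cx : ∀ k w, complexity (θ₀ k w) ≤ 1 := fun k w =>
    (complexity_add_le_holds _ _).trans (by rw [complexity_X_holds, complexity_X_holds])
  have hθcx : ∀ k, ∑ x, complexity (θ k x) ≤ Fintype.card (σ k) := by
    intro k
    rw [Fintype.sum_sum_type]
    have h2 : ∑ j : Fin (u k), complexity (θ k (Sum.inr j)) = 0 :=
      Finset.sum_eq_zero fun j _ => complexity_X_holds _
    have h1 : ∑ w : σ k, complexity (θ k (Sum.inl w)) ≤ ∑ _w : σ k, 1 :=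
      Finset.sum_le_sum fun w _ => (complexity_rename_le_holds' _ _).trans (hθ₀cx k w)
    rw [Finset.sum_const, Finset.card_univ, smul_eq_mul, mul_one] at h1
    omega
  refine ⟨⟨(IsPBounded.add_holds hvars hvars).mono fun k => ?_,
      hdeg.mono fun k => totalDegree_aeval_le_of_le_one _ (hθ₀deg k) _⟩,
    u, fun k => aeval (θ k) (g k),
    ⟨⟨(IsPBounded.add_holds (IsPBounded.add_holds gvars gvars) gvars).mono fun k => ?_,
        gdeg.mono fun k => totalDegree_aeval_le_of_le_one _ (hθdeg k) _⟩,
      (IsPBounded.add_holds gcx hvars).mono fun k =>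
        (complexity_aeval_le (g k) (θ k)).trans (Nat.add_le_add_left (hθcx k) _)⟩,
    fun k => ?_⟩
  · simp only [Fintype.card_sum]
    omega
  · simp only [Fintype.card_sum, Fintype.card_fin]
    omega
  · show aeval (θ₀ k) (f k) = boolSum (aeval (θ k) (g k))
    rw [hfg k, ← boolSum_aeval_extend]

variable [∀ k, DecidableEq (σ k)]

/-- **`VNP` is closed under iterated partial derivatives along arbitrary words** (Valiant 1982;
Bürgisser 2024, §3.1: "`VNP` is closed under `p`-bounded applications of differentiation"),
over EVERY field (v1: characteristic zero; v2: infinite fields; v3: no hypothesis on the field,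
via `IsVNPFamily.coeff_sumAlgEquiv_of_infinite`, which since its v2 holds over every field): if
`(f_k)` is `p`-definable then so is `(∂_{v₁} ⋯ ∂_{v_r} f_k)` for EVERY
choice of words `l_k = [v₁, …, v_{r(k)}]` of variables — no bound on `r(k)` is needed (words longer
than `deg f_k` in some variable give `0`). Proof: `∂_l f = (∏ m_w!) · [T^m] f(X + T)`
(`foldr_pderiv_eq_C_mul_coeff_sumAlgEquiv_taylorShiftAll`), the shifted family is in `VNP`
(`isVNPFamily_taylorShiftAll`), `VNP` is closed under taking coefficients (Prop. 3.1 over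
every field, `IsVNPFamily.coeff_sumAlgEquiv_of_infinite`) and under scalar multiples
(`IsVNPFamily.C_mul`).
[cite: Burgisser2024Completeness, §3.1 (p0013 L39–L40)] [cite: Valiant1982, §3] -/
theorem IsVNPFamily.foldr_pderiv {f : ∀ k, MvPolynomial (σ k) F} (hf : IsVNPFamily f)
    (l : ∀ k, List (σ k)) :
    IsVNPFamily fun k => (l k).foldr (fun j q => pderiv j q) (f k) := by
  have h := IsVNPFamily.C_mul
    (IsVNPFamily.coeff_sumAlgEquiv_of_infinite (isVNPFamily_taylorShiftAll hf)
      fun k => counts (l k))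
    fun k => (((counts (l k)).prod fun _ n => n.factorial : ℕ) : F)
  refine (iff_of_eq (congrArg IsVNPFamily (funext fun k => ?_))).1 h
  exact (foldr_pderiv_eq_C_mul_coeff_sumAlgEquiv_taylorShiftAll (l k) (f k)).symm

/-- The same closure property in the vocabulary of `IteratedDerivations.lean`
(`iterD (dmap pderiv) l`). [cite: Burgisser2024Completeness, §3.1 (p0013 L39–L40)] -/
theorem IsVNPFamily.iterD_pderiv {f : ∀ k, MvPolynomial (σ k) F} (hf : IsVNPFamily f)
    (l : ∀ k, List (σ k)) :
    IsVNPFamily fun k => iterD (dmap fun i : σ k =>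
      (pderiv i : Derivation F (MvPolynomial (σ k) F) (MvPolynomial (σ k) F))) (l k) (f k) := by
  have h := hf.foldr_pderiv l
  refine (iff_of_eq (congrArg IsVNPFamily (funext fun k => ?_))).1 h
  exact foldr_pderiv_eq_iterD (l k) (f k)

/-- `k`-dependent iteration counts: `((∂/∂X_{v_k})^{r(k)} f_k)` is `p`-definable for every
sequence `r : ℕ → ℕ` (no bound needed), generalising `isVNPFamily_pderiv_iterate` (fixed `r`).
[cite: Burgisser2024Completeness, §3.1 (p0013 L39–L40)] -/
theorem IsVNPFamily.pderiv_iterate' {f : ∀ k, MvPolynomial (σ k) F} (hf : IsVNPFamily f)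
    (v : ∀ k, σ k) (r : ℕ → ℕ) :
    IsVNPFamily fun k => (MvPolynomial.pderiv (v k))^[r k] (f k) := by
  have h := hf.foldr_pderiv fun k => List.replicate (r k) (v k)
  refine (iff_of_eq (congrArg IsVNPFamily (funext fun k => ?_))).1 h
  induction r k with
  | zero => rfl
  | succ n ih => rw [List.replicate_succ, List.foldr_cons, ih, Function.iterate_succ_apply']

omit [∀ k, Fintype (σ k)] [∀ k, DecidableEq (σ k)] in
/-- **`VNP` has the closure property that `VP`, `VBP`, `VF` lack unless they contain `VNP`** —
the positive statement in the exact currency of the hypotheses `hVP` / `hVBP` / `hVF` of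
`PermanentAsCoefficient.lean` (`IsVNPFamily.isVPFamily_of_pderiv_closed` & co.): for
`f_k ∈ F[Fin (a k) ⊔ τ_k]` and any lists `l_k` of distinguished variables, differentiating once
with respect to each listed variable keeps a `p`-definable family `p`-definable (no `Nodup`
hypothesis needed). [cite: Burgisser2024Completeness, §3.1 (p0013 L39–L47)] -/
theorem isVNPFamily_foldr_pderiv_inl (a : ℕ → ℕ) (τ : ℕ → Type) [∀ k, Fintype (τ k)]
    [∀ k, DecidableEq (τ k)] (f : ∀ k, MvPolynomial (Fin (a k) ⊕ τ k) F)
    (l : ∀ k, List (Fin (a k))) (hf : IsVNPFamily f) :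
    IsVNPFamily fun k => (l k).foldr (fun j p => pderiv (Sum.inl j) p) (f k) := by
  have h := hf.foldr_pderiv fun k => (l k).map Sum.inl
  refine (iff_of_eq (congrArg IsVNPFamily (funext fun k => ?_))).1 h
  rw [List.foldr_map]

end Family

/-! ## The survey's dichotomies for `VP` as equivalences (characteristic `≠ 2`; characteristic zero)

Bürgisser 2024, §3.1: "none of the classes `VF`, `VBP` and `VP` shares this property [closure
under taking coefficients], if `VP ≠ VNP`" and "the classes `VF`, `VBP`, and `VP` fail to be
closed under these operations [differentiation]" — for `VP` both remarks are EQUIVALENCES with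
`VNP ⊆ VP` (i.e. `VP = VNP`): the forward implications are `PermanentAsCoefficient.lean`'s, the
converses follow from the closure of `VNP` (Prop. 3.1 and this file). -/

section Equivalences

variable {F : Type u} [Field F]

/-- Transfer: a hypothesis "`VNP ⊆ VP`" stated for families in the variables `Fin (v n)` applies
to every family in finitely many variables (rename along `σ_k ≃ Fin #σ_k`;
`IsVNPFamily.renameEquiv`, `isVPFamily_renameEquiv_iff`). [cite: Burgisser2000, Rem. 2.2] -/
theorem IsVNPFamily.isVPFamily_of_forall_fin
    (hVNP : ∀ (v : ℕ → ℕ) (g : ∀ n, MvPolynomial (Fin (v n)) F), IsVNPFamily g → IsVPFamily g)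
    {σ : ℕ → Type v} [∀ k, Fintype (σ k)] {h : ∀ k, MvPolynomial (σ k) F} (hh : IsVNPFamily h) :
    IsVPFamily h := by
  let e : ∀ k, σ k ≃ Fin (Fintype.card (σ k)) := fun k => Fintype.equivFin (σ k)
  have h1 : IsVNPFamily fun k => MvPolynomial.renameEquiv F (e k) (h k) :=
    IsVNPFamily.renameEquiv e hh
  have h2 : IsVPFamily fun k => MvPolynomial.renameEquiv F (e k) (h k) :=
    hVNP (fun k => Fintype.card (σ k)) _ h1
  exact (isVPFamily_renameEquiv_iff e h).1 h2

/-- **"`VP` is closed under taking coefficients ⟺ `VNP ⊆ VP`" over every field of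
characteristic `≠ 2`** (Bürgisser 2024, §3.1, Prop. 3.1 and the remark following it, in the
survey's own generality "char 𝔽 ≠ 2", p0013 L28). (→) `IsVNPFamily.isVPFamily_of_coeff_closed`
(`PER` as a coefficient, Valiant's completeness of `PER` in characteristic `≠ 2`); (←) `VP ⊆ VNP`,
Prop. 3.1 over every field (`IsVNPFamily.coeff_of_infinite`, no field hypothesis since its v2) and
the hypothesis. Nothing is asserted about which side holds.
[cite: Burgisser2024Completeness, Prop. 3.1 and §3.1 (p0013 L17–L37)] -/
theorem vp_closed_under_coeff_iff_vnp_subset_vp_of_ringChar_ne_two (h2 : ringChar F ≠ 2) :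
    (∀ (a : ℕ → ℕ) (τ : ℕ → Type) [∀ k, Fintype (τ k)] [∀ k, DecidableEq (τ k)]
        (f : ∀ k, MvPolynomial (Fin (a k) ⊕ τ k) F) (m : ∀ k, Fin (a k) →₀ ℕ), IsVPFamily f →
        IsVPFamily fun k => MvPolynomial.coeff (m k) (sumAlgEquiv F (Fin (a k)) (τ k) (f k))) ↔
      (∀ (v : ℕ → ℕ) (g : ∀ n, MvPolynomial (Fin (v n)) F), IsVNPFamily g → IsVPFamily g) := by
  constructor
  · intro hVP v g hg
    exact IsVNPFamily.isVPFamily_of_coeff_closed h2 hVP hg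
  · intro hVNP a τ _ _ f m hf
    exact IsVNPFamily.isVPFamily_of_forall_fin hVNP
      (IsVNPFamily.coeff_of_infinite (IsVPFamily.isVNPFamily_holds' hf) m)

/-- **"`VP` is closed under `p`-bounded differentiation ⟺ `VNP ⊆ VP`" over every field of
characteristic `≠ 2`** (Bürgisser 2024, §3.1), "closed under differentiation" in the shape of
`PermanentAsCoefficient.lean`. (→) `IsVNPFamily.isVPFamily_of_pderiv_closed`; (←) `VP ⊆ VNP`,
`isVNPFamily_foldr_pderiv_inl` (every field since v3) and the hypothesis.
[cite: Burgisser2024Completeness, §3.1 (p0013 L39–L47)] -/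
theorem vp_closed_under_pderiv_iff_vnp_subset_vp_of_ringChar_ne_two (h2 : ringChar F ≠ 2) :
    (∀ (a : ℕ → ℕ) (τ : ℕ → Type) [∀ k, Fintype (τ k)] [∀ k, DecidableEq (τ k)]
        (f : ∀ k, MvPolynomial (Fin (a k) ⊕ τ k) F) (l : ∀ k, List (Fin (a k))),
        (∀ k, (l k).Nodup) → IsVPFamily f →
        IsVPFamily fun k => (l k).foldr (fun j p => pderiv (Sum.inl j) p) (f k)) ↔
      (∀ (v : ℕ → ℕ) (g : ∀ n, MvPolynomial (Fin (v n)) F), IsVNPFamily g → IsVPFamily g) := by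
  constructor
  · intro hVP v g hg
    exact IsVNPFamily.isVPFamily_of_pderiv_closed h2 hVP hg
  · intro hVNP a τ _ _ f l _ hf
    exact IsVNPFamily.isVPFamily_of_forall_fin hVNP
      (isVNPFamily_foldr_pderiv_inl a τ f l (IsVPFamily.isVNPFamily_holds' hf))

variable [CharZero F]

/-- In characteristic zero the ring characteristic is not `2`. [cite: Burgisser2024Completeness, §3.1 (p0013 L28)] -/
private theorem ringChar_ne_two : ringChar F ≠ 2 := by
  rw [ringChar.eq_zero]
  decide

/-- **"`VP` is closed under taking coefficients ⟺ `VNP ⊆ VP`"** (Bürgisser 2024, §3.1, Prop. 3.1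
and the remark following it), characteristic zero. (→) `PermanentAsCoefficient.lean`
(`IsVNPFamily.isVPFamily_of_coeff_closed`: `PER_n = [y₁⋯yₙ] ∏ᵢ Σⱼ x_ij y_j` and Valiant's
completeness of `PER`); (←) a `VP` family is in `VNP` (`IsVPFamily.isVNPFamily_holds'`), its
coefficient sequences are in `VNP` (Prop. 3.1, `IsVNPFamily.coeff`), hence in `VP` by hypothesis
(`IsVNPFamily.isVPFamily_of_forall_fin`). Nothing is asserted about which side holds.
[cite: Burgisser2024Completeness, Prop. 3.1 and §3.1 (p0013 L17–L37)] -/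
theorem vp_closed_under_coeff_iff_vnp_subset_vp :
    (∀ (a : ℕ → ℕ) (τ : ℕ → Type) [∀ k, Fintype (τ k)] [∀ k, DecidableEq (τ k)]
        (f : ∀ k, MvPolynomial (Fin (a k) ⊕ τ k) F) (m : ∀ k, Fin (a k) →₀ ℕ), IsVPFamily f →
        IsVPFamily fun k => MvPolynomial.coeff (m k) (sumAlgEquiv F (Fin (a k)) (τ k) (f k))) ↔
      (∀ (v : ℕ → ℕ) (g : ∀ n, MvPolynomial (Fin (v n)) F), IsVNPFamily g → IsVPFamily g) :=
  vp_closed_under_coeff_iff_vnp_subset_vp_of_ringChar_ne_two ringChar_ne_two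

/-- **"`VP` is closed under `p`-bounded differentiation ⟺ `VNP ⊆ VP`"** (Bürgisser 2024, §3.1),
characteristic zero, with "closed under differentiation" in the shape of
`PermanentAsCoefficient.lean` (differentiate once with respect to each variable of a duplicate-free
list of distinguished variables). (→) `IsVNPFamily.isVPFamily_of_pderiv_closed`
(`∂_{y₁}⋯∂_{yₙ} ∏ᵢ Σⱼ x_ij y_j = PER_n`); (←) `VP ⊆ VNP`, `VNP` IS closed under these derivatives
(`isVNPFamily_foldr_pderiv_inl`), and the hypothesis. Nothing is asserted about which side holds.
[cite: Burgisser2024Completeness, §3.1 (p0013 L39–L47)] -/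
theorem vp_closed_under_pderiv_iff_vnp_subset_vp :
    (∀ (a : ℕ → ℕ) (τ : ℕ → Type) [∀ k, Fintype (τ k)] [∀ k, DecidableEq (τ k)]
        (f : ∀ k, MvPolynomial (Fin (a k) ⊕ τ k) F) (l : ∀ k, List (Fin (a k))),
        (∀ k, (l k).Nodup) → IsVPFamily f →
        IsVPFamily fun k => (l k).foldr (fun j p => pderiv (Sum.inl j) p) (f k)) ↔
      (∀ (v : ℕ → ℕ) (g : ∀ n, MvPolynomial (Fin (v n)) F), IsVNPFamily g → IsVPFamily g) :=
  vp_closed_under_pderiv_iff_vnp_subset_vp_of_ringChar_ne_two ringChar_ne_two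

end Equivalences

end Literature.Computability.AlgebraicComplexity

end
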